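import Summits.QuantumFields.BalabanUV.Beta.MultiscaleDecay
import Literature.MathematicalPhysics.QuantumFieldTheory.Balaban1983to89.B9Thm37GlueTorusCovComp

/-!
# `T4Continuum.ShellMeasureSlotCubeFamily` — ROW J2 (owner R-ne7cp1-g37-7 (b)): THE CUBE-FAMILY DATA `hdisj hcover hsupp hscale_lo∕hi`
# OF THE (L1) ENDs `Beta/MultiscaleDecay.decay_levelOp_flat∕_cov` INHABITED BY A SLOT-SHAPED TWO-LEVEL BLOCK GEOMETRY ON `UT N`
(cell `pub-balaban`, sub-cell `t4`, spine estimate NE7c (node U5b); NE7c ROUND-2 crew, unit `b2b-balaban-t4-ne7c-formalise-leaf-06` gen 10;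
post-v6 ESTIMATE LANE, junction row J2 = S117 (journal l.23530, claimed l.23635); ADDITIVE — imports `Beta/MultiscaleDecay` + `B9Thm37GlueTorusCovComp`
(`tblk_ctrU_tblk`, nested blockings) ONLY; [folklore] torus
arithmetic; data `def`s (`side Cell lvl base subIdx subOf zc meanProfile treeWeight`), 0 `def … : Prop`, 0 sorry, 0 citation tags; touches NO
host, moves NO census row)

HONEST FRAMING.  Finite four-torus programme, rung (B)+1 only — NOT infinite volume, NOT a mass gap, NOT the Clay problem, NOT summit progress.
NE7c (`T4IndicatorShell.ShellWeightBound`) is NOT PRINTED in [Balaban 1983–89] and NOT PROVED; «NE7c ⇐ the named binders» (THE ONE CALL of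
record v4 p238484, 84 displayed [T]; v5 63).  This file is junction work ON OUR SIDE: it CONSTRUCTS a concrete covering cube family on the MODEL
torus of the row-D4 `Beta/` multiscale library and PROVES that library's five GEOMETRIC hypotheses for it; nothing about Bałaban's minimisers,
propagators or kernels is computed, asserted, cited or discharged; NOTHING in either countdown moves (spine PROVED 0∕9; row D4 unchanged).
HONEST DEPENDENCY (cell): continuum YM on T⁴ ⇐ BetaPertH ∧ nine spine estimates (0/9 proved); BetaPertH ⇐ (D1) ∧ (D4) ∧ CAP+tail; G-an2-4
gates asym, D1 and NE2/3/4.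

THE GEOMETRY (DATA).  Torus `UT N`, a FINE side `s ≥ 1`, a ratio `L ≥ 1`, the COARSE side `L·s ∣ N_i`, and ANY finite set `Λ` of coarse blocks
(`Ctr N (L·s)`) — «the slot»: blocks in `Λ` are REFINED into their `L^d` sub-cubes of side `s` (the slot's own cells, one live level finer),
every other coarse block is ONE cell of side `L·s` (the window's coarse cells).  Levels `Bool` (`true` = coarse, `false` = fine); cells
`Cell Λ = {z ∉ Λ} ⊕ ({z ∈ Λ} × (Fin d → Fin L))`; corner index `zc` = `z`, resp. the fine index `L·z + w`.  This is the shape of leaf-05-g12's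
J1b `example` (torus `(4r)^d`, `s = r`, `L = 2`, `Λ` = one corner block) and of the J1 dictionary's two-level window (D5); `Λ = ∅ ∕ univ` give
the one-level families.
CONTENT (kernel).  §1 nested grids (`nC (N i) s = L·nC (N i) (L·s)`, `subIdx`, `subOf`).  §2 the family, its charts, the coarse label
`tblk_coarse_cellPt = base`.  §3 **`cells_disjoint`** = `hdisj` and **`cells_cover`** = `hcover` LITERALLY in the binder shapes shared by
`MultiscaleDecay.decay_levelOp_*`, `MultiscaleCoerciveTorus(Cov)`, `MultiscaleDecayDirichlet`, `MultiscaleParametrixTorus*`, `…CombesThomasL2Cells`,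
`MultiscaleSupMember`; the membership test **`exists_cell_iff`**; the site scale **`siteScale_eq`** (`n(x) = s` on the slot, `L·s` off it — the
local prefactor of (D3)∕(D5) explicit).  §4 the DESIGNED data of J1 (D1): **`meanProfile`** `ω_l = S_l^{−d}` on the level-`l` cells' blocks, `0`
elsewhere (block MEANS) with **`meanProfile_supp`** = `hsupp`, `meanProfile_corner`; **`treeWeight d s L α l = α_l·S_l^d∕S_l²`** ((D1)'s
`a_l := a_j·S_j^{d−2}`) with **`scale_eq`** (`a_l·ω_l(corner)²·S_l^d = α_l∕S_l²` EXACTLY) and **`scale_lo ∕ scale_hi`** = `hscale_lo∕hi` from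
`a_min ≤ α_l ≤ a_max` — print's recursion range, nothing else.  §5 END **`decay_levelOp_flat_slot`**: `decay_levelOp_flat` FIRED BY NAME on this
family with EVERY geometric binder supplied — displayed remain exactly the operator data (`c_min ≤ |c_b| ≤ c_max`, `a_min ≤ α_l ≤ a_max`,
`κ ∈ [0,1]`, `μ₀ > 0`); the covariant END `decay_levelOp_cov` (`+ hgauge hloss`, row J1b) takes the SAME five terms.  NOT DONE HERE: node O's
identification of the u-tuple's `𝒢 H₁ H k·`; the `UT N`∕`sdist` ↔ `TPt`∕`pl1` bridge to the hosts (J3); `hgauge` (E7's species).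
-/

noncomputable section

namespace Summit.QuantumFields.BalabanUV.T4Continuum.ShellMeasureSlotCubeFamily

open Summit.QuantumFields.BalabanUV.Beta.BoxPoincare (Box)
open Summit.QuantumFields.BalabanUV.Beta.MultiscaleCoerciveTorus
open Summit.QuantumFields.BalabanUV.Beta.MultiscaleDecayBudget (siteScale siteScale_cellPt)
open Summit.QuantumFields.BalabanUV.Beta.MultiscaleDecay (decay_levelOp_flat)
open Summit.QuantumFields.BalabanUV.Beta.MultiscaleDistance (sdist)
open Literature.MathematicalPhysics.QuantumFieldTheory.Balaban1983to89
open Literature.MathematicalPhysics.QuantumFieldTheory.Balaban1983to89.B9Thm37GluePU (bsrc btgt)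
open Literature.MathematicalPhysics.QuantumFieldTheory.Balaban1983to89.B9Thm37GlueTorusCov (tblk tblk_val)
open Literature.MathematicalPhysics.QuantumFieldTheory.Balaban1983to89.B9Thm37GlueTorusCovComp (tblk_ctrU_tblk)
open Literature.MathematicalPhysics.QuantumFieldTheory.Balaban1983to89.B9Thm37GlueTorusCovLevels (levelOp)
open B5TorusCover (UT Ctr ctrU nC)

variable {d : ℕ} {N : Fin d → ℕ} [∀ i, NeZero (N i)]

/-! ## §1 Two nested grids on the torus: fine side `s`, coarse side `L * s` -/

section Grids

variable {s L : ℕ}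

/-- `1 ≤ s`, `1 ≤ L` ⟹ `1 ≤ L * s`. [folklore] -/
theorem one_le_coarse (hs : 1 ≤ s) (hL : 1 ≤ L) : 1 ≤ L * s := Nat.one_le_iff_ne_zero.mpr (Nat.mul_ne_zero (by omega) (by omega))

omit [∀ i, NeZero (N i)] in
/-- `L * s ∣ N_i` ⟹ `s ∣ N_i`. [folklore] -/
theorem dvd_fine (hdiv : ∀ i, L * s ∣ N i) (i : Fin d) : s ∣ N i := Dvd.dvd.trans (Dvd.intro_left L rfl) (hdiv i)

/-- **The fine grid has `L` times as many blocks per axis as the coarse grid**: `nC (N i) s = L · nC (N i) (L s)`. [folklore] -/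
theorem nC_fine_eq (hs : 1 ≤ s) (hL : 1 ≤ L) (hdiv : ∀ i, L * s ∣ N i) (i : Fin d) : nC (N i) s = L * nC (N i) (L * s) := by
  obtain ⟨q, hq⟩ := hdiv i
  have hq0 : q ≠ 0 := by rintro rfl; exact NeZero.ne (N i) (by rw [hq, mul_zero])
  have hc : N i / (L * s) = q := by rw [hq, Nat.mul_div_cancel_left q (Nat.mul_pos (by omega) (by omega))]
  have hf : N i / s = L * q := by
    rw [hq, show L * s * q = s * (L * q) by ring, Nat.mul_div_cancel_left _ (by omega : 0 < s)]
  have hLq : 1 ≤ L * q := Nat.one_le_iff_ne_zero.mpr (Nat.mul_ne_zero (by omega) hq0)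
  rw [B5TorusCover.nC_eq_div (by rw [hf]; exact hLq), B5TorusCover.nC_eq_div (by rw [hc]; exact Nat.one_le_iff_ne_zero.mpr hq0), hc, hf]

/-- **The fine index of the sub-cube `w` of the coarse block `z`**: coordinates `L·z_i + w_i`. [folklore] -/
def subIdx (hs : 1 ≤ s) (hL : 1 ≤ L) (hdiv : ∀ i, L * s ∣ N i) (z : Ctr N (L * s)) (w : Fin d → Fin L) : Ctr N s :=
  fun i => ⟨L * (z i : ℕ) + (w i : ℕ), by
    rw [nC_fine_eq hs hL hdiv i]
    have hz : (z i : ℕ) + 1 ≤ nC (N i) (L * s) := (z i).isLt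
    have hw : (w i : ℕ) < L := (w i).isLt
    calc L * (z i : ℕ) + (w i : ℕ) < L * (z i : ℕ) + L := by omega
      _ = L * ((z i : ℕ) + 1) := by ring
      _ ≤ L * nC (N i) (L * s) := Nat.mul_le_mul_left _ hz⟩

/-- Coordinates of the fine index. [folklore] -/
theorem subIdx_val (hs : 1 ≤ s) (hL : 1 ≤ L) (hdiv : ∀ i, L * s ∣ N i) (z : Ctr N (L * s)) (w : Fin d → Fin L) (i : Fin d) :
    (subIdx hs hL hdiv z w i : ℕ) = L * (z i : ℕ) + (w i : ℕ) := rfl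

/-- The fine index determines the coarse block and the sub-cube. [folklore] -/
theorem subIdx_inj (hs : 1 ≤ s) (hL : 1 ≤ L) (hdiv : ∀ i, L * s ∣ N i) {z z' : Ctr N (L * s)} {w w' : Fin d → Fin L}
    (h : subIdx hs hL hdiv z w = subIdx hs hL hdiv z' w') : z = z' ∧ w = w' := by
  have hc : ∀ i, L * (z i : ℕ) + (w i : ℕ) = L * (z' i : ℕ) + (w' i : ℕ) := fun i => by
    have := congrArg (fun y : Ctr N s => ((y i : ℕ))) h
    simpa only [subIdx_val] using this
  have hL0 : 0 < L := by omega
  have hz : ∀ i, (z i : ℕ) = (z' i : ℕ) := fun i => by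
    have h1 : (L * (z i : ℕ) + (w i : ℕ)) / L = (L * (z' i : ℕ) + (w' i : ℕ)) / L := by rw [hc i]
    rwa [Nat.mul_add_div hL0, Nat.mul_add_div hL0, Nat.div_eq_of_lt (w i).isLt, Nat.div_eq_of_lt (w' i).isLt, add_zero,
      add_zero] at h1
  exact ⟨funext fun i => Fin.ext (hz i), funext fun i => Fin.ext (by have := hc i; rw [hz i] at this; omega)⟩

/-- The sub-cube index of a point of the slot: `w_i = (x_i ∕ s) mod L`. [folklore] -/
def subOf (hs : 1 ≤ s) (hL : 1 ≤ L) (hdiv : ∀ i, L * s ∣ N i) (x : UT N) : Fin d → Fin L :=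
  fun i => ⟨(tblk hs (dvd_fine hdiv) x i : ℕ) % L, Nat.mod_lt _ (Nat.lt_of_lt_of_le Nat.zero_lt_one hL)⟩

/-- The fine label of `x` is the fine index of (coarse label of `x`, sub-cube index of `x`). [folklore] -/
theorem subIdx_tblk_subOf (hs : 1 ≤ s) (hL : 1 ≤ L) (hdiv : ∀ i, L * s ∣ N i) (x : UT N) :
    subIdx hs hL hdiv (tblk (one_le_coarse hs hL) hdiv x) (subOf hs hL hdiv x) = tblk hs (dvd_fine hdiv) x := by
  funext i
  apply Fin.ext
  rw [subIdx_val, tblk_val, tblk_val]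
  show L * ((UT.toSite N x i : ℕ) / (L * s)) + (UT.toSite N x i : ℕ) / s % L = (UT.toSite N x i : ℕ) / s
  rw [mul_comm L s, ← Nat.div_div_eq_div_mul]
  exact Nat.div_add_mod _ _

end Grids

/-! ## §2 The slot family: coarse blocks off `Λ`, fine sub-cubes on `Λ` -/

section Family

variable (s L : ℕ)

/-- The two sides: `true` ↦ the COARSE side `L·s`, `false` ↦ the FINE side `s`. [folklore] -/
def side : Bool → ℕ
  | true => L * s
  | false => s

variable {s L}

/-- Both sides are `≥ 1`. [folklore] -/
theorem side_pos (hs : 1 ≤ s) (hL : 1 ≤ L) : ∀ l, 1 ≤ side s L l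
  | true => one_le_coarse hs hL
  | false => hs

omit [∀ i, NeZero (N i)] in
/-- Both sides divide the periods. [folklore] -/
theorem side_dvd (hdiv : ∀ i, L * s ∣ N i) : ∀ l i, side s L l ∣ N i
  | true => hdiv
  | false => dvd_fine hdiv

variable (s L) in
/-- **THE CELLS OF THE SLOT FAMILY**: an unrefined coarse block `z ∉ Λ`, or a fine sub-cube `(z, w)` of a refined block `z ∈ Λ`. [folklore] -/
abbrev Cell (Λ : Finset (Ctr N (L * s))) : Type :=
  {z : Ctr N (L * s) // z ∉ Λ} ⊕ ({z : Ctr N (L * s) // z ∈ Λ} × (Fin d → Fin L))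

variable {Λ : Finset (Ctr N (L * s))}

/-- The level of a cell: coarse (`true`) off the slot, fine (`false`) on it. [folklore] -/
def lvl : Cell s L Λ → Bool
  | Sum.inl _ => true
  | Sum.inr _ => false

/-- The coarse block a cell lies in. [folklore] -/
def base : Cell s L Λ → Ctr N (L * s)
  | Sum.inl z => z.1
  | Sum.inr zw => zw.1.1

omit [∀ i, NeZero (N i)] in
/-- **A cell lies on the slot iff it is fine**: `base k ∈ Λ ↔ lvl k = false`. [folklore] -/
theorem base_mem_iff : ∀ k : Cell s L Λ, base k ∈ Λ ↔ lvl k = false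
  | Sum.inl z => by simpa [base, lvl] using z.2
  | Sum.inr zw => by simp [base, lvl]

/-- **The corner index of a cell** in its own level's grid: `z` for a coarse cell, `L·z + w` for the sub-cube `w` of `z`. [folklore] -/
def zc (hs : 1 ≤ s) (hL : 1 ≤ L) (hdiv : ∀ i, L * s ∣ N i) : (k : Cell s L Λ) → Ctr N (side s L (lvl k))
  | Sum.inl z => z.1
  | Sum.inr zw => subIdx hs hL hdiv zw.1.1 zw.2

variable (hs : 1 ≤ s) (hL : 1 ≤ L) (hdiv : ∀ i, L * s ∣ N i)

/-- The chart of a coarse cell is the coarse cube chart. [folklore] -/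
theorem cellPt_inl (z : {z : Ctr N (L * s) // z ∉ Λ}) (v : Box d (L * s)) :
    cellPt (side s L) (side_pos hs hL) (side_dvd hdiv) lvl (zc hs hL hdiv) (Sum.inl z) v =
      cubePt (one_le_coarse hs hL) hdiv z.1 v := rfl

/-- The chart of a fine cell is the fine cube chart at the fine index. [folklore] -/
theorem cellPt_inr (zw : {z : Ctr N (L * s) // z ∈ Λ} × (Fin d → Fin L)) (v : Box d s) :
    cellPt (side s L) (side_pos hs hL) (side_dvd hdiv) lvl (zc hs hL hdiv) (Sum.inr zw) v =
      cubePt hs (dvd_fine hdiv) (subIdx hs hL hdiv zw.1.1 zw.2) v := rfl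

/-- **Every point of a cell has the cell's coarse block as its coarse label.** [folklore] -/
theorem tblk_coarse_cellPt : ∀ (k : Cell s L Λ) (v : Box d (side s L (lvl k))),
    tblk (one_le_coarse hs hL) hdiv (cellPt (side s L) (side_pos hs hL) (side_dvd hdiv) lvl (zc hs hL hdiv) k v) = base k
  | Sum.inl z, v => by rw [cellPt_inl]; exact tblk_cubePt _ _ _ _
  | Sum.inr zw, v => by
      rw [cellPt_inr]
      funext i
      apply Fin.ext
      rw [tblk_val, cubePt_val, subIdx_val]
      have hv : (v i : ℕ) < s := (v i).isLt
      have hlt : (v i : ℕ) + s * (zw.2 i : ℕ) < L * s := by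
        calc (v i : ℕ) + s * (zw.2 i : ℕ) < s * ((zw.2 i : ℕ) + 1) := by rw [mul_add, mul_one]; omega
          _ ≤ s * L := Nat.mul_le_mul_left _ (zw.2 i).isLt
          _ = L * s := mul_comm _ _
      rw [show (v i : ℕ) + s * (L * (zw.1.1 i : ℕ) + (zw.2 i : ℕ)) = (v i : ℕ) + s * (zw.2 i : ℕ) + L * s * (zw.1.1 i : ℕ) by ring,
        Nat.add_mul_div_left _ _ (by positivity : 0 < L * s), Nat.div_eq_of_lt hlt, zero_add]
      rfl

/-- The fine label of a point of a fine cell is the cell's fine index. [folklore] -/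
theorem tblk_fine_cellPt_inr (zw : {z : Ctr N (L * s) // z ∈ Λ} × (Fin d → Fin L)) (v : Box d s) :
    tblk hs (dvd_fine hdiv) (cellPt (side s L) (side_pos hs hL) (side_dvd hdiv) lvl (zc hs hL hdiv) (Sum.inr zw) v) =
      subIdx hs hL hdiv zw.1.1 zw.2 := by
  rw [cellPt_inr]; exact tblk_cubePt _ _ _ _

/-! ## §3 `hdisj`, `hcover`, the membership test and the site scale -/

/-- **`hdisj` OF THE (L1) ENDs FOR THE SLOT FAMILY: distinct cells have disjoint charts.** [folklore] -/
theorem cells_disjoint : ∀ (k k' : Cell s L Λ) (v : Box d (side s L (lvl k))) (v' : Box d (side s L (lvl k'))),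
    cellPt (side s L) (side_pos hs hL) (side_dvd hdiv) lvl (zc hs hL hdiv) k v =
      cellPt (side s L) (side_pos hs hL) (side_dvd hdiv) lvl (zc hs hL hdiv) k' v' → k = k' := by
  intro k k' v v' h
  have hb : base k = base k' := by
    rw [← tblk_coarse_cellPt hs hL hdiv k v, h, tblk_coarse_cellPt hs hL hdiv k' v']
  cases k with
  | inl z => cases k' with
    | inl z' => exact congrArg Sum.inl (Subtype.ext hb)
    | inr zw' => exact absurd ((show z.1 = zw'.1.1 from hb) ▸ zw'.1.2) z.2
  | inr zw => cases k' with
    | inl z' => exact absurd ((show zw.1.1 = z'.1 from hb) ▸ zw.1.2) z'.2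
    | inr zw' =>
      have hf : subIdx hs hL hdiv zw.1.1 zw.2 = subIdx hs hL hdiv zw'.1.1 zw'.2 := by
        rw [← tblk_fine_cellPt_inr hs hL hdiv zw v, h, tblk_fine_cellPt_inr hs hL hdiv zw' v']
      obtain ⟨hz, hw⟩ := subIdx_inj hs hL hdiv hf
      exact congrArg Sum.inr (Prod.ext (Subtype.ext hz) hw)

/-- **A point OFF the slot lies in the coarse cell of its coarse label.** [folklore] -/
theorem cellPt_inl_offV (x : UT N) (hx : tblk (one_le_coarse hs hL) hdiv x ∉ Λ) :
    cellPt (side s L) (side_pos hs hL) (side_dvd hdiv) lvl (zc hs hL hdiv) (Sum.inl ⟨_, hx⟩) (offV (one_le_coarse hs hL) x) = x := by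
  rw [cellPt_inl]; exact cubePt_tblk_offV _ _ _

/-- **A point ON the slot lies in the fine cell of its (coarse label, sub-cube index).** [folklore] -/
theorem cellPt_inr_offV (x : UT N) (hx : tblk (one_le_coarse hs hL) hdiv x ∈ Λ) :
    cellPt (side s L) (side_pos hs hL) (side_dvd hdiv) lvl (zc hs hL hdiv) (Sum.inr (⟨_, hx⟩, subOf hs hL hdiv x)) (offV hs x) = x := by
  rw [cellPt_inr]
  show cubePt hs (dvd_fine hdiv) (subIdx hs hL hdiv (tblk (one_le_coarse hs hL) hdiv x) (subOf hs hL hdiv x)) (offV hs x) = x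
  rw [subIdx_tblk_subOf]; exact cubePt_tblk_offV _ _ _

/-- **`hcover` OF THE (L1) ENDs FOR THE SLOT FAMILY: the cells cover the torus.** [folklore] -/
theorem cells_cover : ∀ x : UT N, ∃ k : Cell s L Λ, ∃ v : Box d (side s L (lvl k)),
    cellPt (side s L) (side_pos hs hL) (side_dvd hdiv) lvl (zc hs hL hdiv) k v = x := by
  intro x
  by_cases hx : tblk (one_le_coarse hs hL) hdiv x ∈ Λ
  · exact ⟨Sum.inr (⟨_, hx⟩, subOf hs hL hdiv x), offV hs x, cellPt_inr_offV hs hL hdiv x hx⟩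
  · exact ⟨Sum.inl ⟨_, hx⟩, offV (one_le_coarse hs hL) x, cellPt_inl_offV hs hL hdiv x hx⟩

/-- **THE MEMBERSHIP TEST**: `x` lies in a cell of level `l` iff (`x`'s coarse block is on the slot ↔ `l` is the fine level). [folklore] -/
theorem exists_cell_iff (l : Bool) (x : UT N) :
    (∃ (k : Cell s L Λ) (v : Box d (side s L (lvl k))),
        lvl k = l ∧ cellPt (side s L) (side_pos hs hL) (side_dvd hdiv) lvl (zc hs hL hdiv) k v = x) ↔
      (tblk (one_le_coarse hs hL) hdiv x ∈ Λ ↔ l = false) := by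
  constructor
  · rintro ⟨k, v, hl, hx⟩
    rw [← hx, tblk_coarse_cellPt hs hL hdiv k v, ← hl]
    exact base_mem_iff k
  · intro h
    by_cases hx : tblk (one_le_coarse hs hL) hdiv x ∈ Λ
    · exact ⟨Sum.inr (⟨_, hx⟩, subOf hs hL hdiv x), offV hs x, (h.mp hx).symm, cellPt_inr_offV hs hL hdiv x hx⟩
    · refine ⟨Sum.inl ⟨_, hx⟩, offV (one_le_coarse hs hL) x, ?_, cellPt_inl_offV hs hL hdiv x hx⟩
      cases l
      · exact absurd (h.mpr rfl) hx
      · rfl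

/-- **THE SITE SCALE OF THE SLOT FAMILY**: `n(x) = s` on the slot, `n(x) = L·s` off it. [folklore] -/
theorem siteScale_eq (x : UT N) :
    siteScale (side s L) (side_pos hs hL) (side_dvd hdiv) lvl (zc hs hL hdiv) (cells_cover (Λ := Λ) hs hL hdiv) x =
      if tblk (one_le_coarse hs hL) hdiv x ∈ Λ then s else L * s := by
  by_cases hx : tblk (one_le_coarse hs hL) hdiv x ∈ Λ
  · conv_lhs => rw [← cellPt_inr_offV hs hL hdiv x hx]
    rw [if_pos hx, siteScale_cellPt _ _ _ _ _ (cells_disjoint hs hL hdiv) (cells_cover hs hL hdiv)]; rfl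
  · conv_lhs => rw [← cellPt_inl_offV hs hL hdiv x hx]
    rw [if_neg hx, siteScale_cellPt _ _ _ _ _ (cells_disjoint hs hL hdiv) (cells_cover hs hL hdiv)]; rfl

/-! ## §4 The designed profile and level weights of the J1 dictionary: `hsupp`, `hscale_lo`, `hscale_hi` -/

/-- **THE MEAN PROFILE** (J1 dictionary (D1): `ω_l ≡ S_l^{−d}` on the level-`l` cells, block MEANS): `ω_l(β) = S_l^{−d}` if `β`'s coarse
block carries level-`l` cells (on the slot for the fine level, off it for the coarse one), else `0`. [folklore] -/
def meanProfile (hs : 1 ≤ s) (hL : 1 ≤ L) (hdiv : ∀ i, L * s ∣ N i) (Λ : Finset (Ctr N (L * s))) (l : Bool) (β : UT N) : ℝ :=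
  if (tblk (one_le_coarse hs hL) hdiv β ∈ Λ ↔ l = false) then (((side s L l : ℕ) : ℝ) ^ d)⁻¹ else 0

/-- The coarse label of the level-`l` corner of `x` is the coarse label of `x` (both grids refine the coarse one). [folklore] -/
theorem tblk_coarse_corner (l : Bool) (x : UT N) :
    tblk (one_le_coarse hs hL) hdiv (ctrU N (side s L l) (tblk (side_pos hs hL l) (side_dvd hdiv l) x)) =
      tblk (one_le_coarse hs hL) hdiv x :=
  tblk_ctrU_tblk _ _ _ _ (by cases l <;> simp [side]) x

/-- **`hsupp` OF THE (L1) ENDs FOR THE SLOT FAMILY: the mean profile of level `l` lives on the level-`l` cells.** [folklore] -/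
theorem meanProfile_supp : ∀ (l : Bool) (x : UT N),
    meanProfile hs hL hdiv Λ l (ctrU N (side s L l) (tblk (side_pos hs hL l) (side_dvd hdiv l) x)) ≠ 0 →
      ∃ (k : Cell s L Λ) (v : Box d (side s L (lvl k))),
        lvl k = l ∧ cellPt (side s L) (side_pos hs hL) (side_dvd hdiv) lvl (zc hs hL hdiv) k v = x := by
  intro l x h
  rw [exists_cell_iff]
  by_contra hc
  exact h (by unfold meanProfile; rw [tblk_coarse_corner hs hL hdiv l x, if_neg hc])

/-- The corner of cell `k` is a point of cell `k` (offset `0`). [folklore] -/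
theorem ctrU_zc_eq_cellPt (k : Cell s L Λ) : ctrU N (side s L (lvl k)) (zc hs hL hdiv k) =
    cellPt (side s L) (side_pos hs hL) (side_dvd hdiv) lvl (zc hs hL hdiv) k (fun _ => ⟨0, side_pos hs hL (lvl k)⟩) :=
  (cubePt_zero _ _ _).symm

/-- **The mean profile at the corner of cell `k` is `S_{l_k}^{−d}`.** [folklore] -/
theorem meanProfile_corner (k : Cell s L Λ) :
    meanProfile hs hL hdiv Λ (lvl k) (ctrU N (side s L (lvl k)) (zc hs hL hdiv k)) = (((side s L (lvl k) : ℕ) : ℝ) ^ d)⁻¹ := by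
  unfold meanProfile
  rw [ctrU_zc_eq_cellPt hs hL hdiv k, tblk_coarse_cellPt hs hL hdiv k, if_pos (base_mem_iff k)]

/-- **THE TREE LEVEL WEIGHTS** (J1 dictionary (D1): `a_l := a_j·S_j^{d−2}` for print's level coefficient `a_j =: α_l`):
`treeWeight α l = α_l·S_l^d ∕ S_l^2`. [folklore] -/
def treeWeight (d s L : ℕ) (α : Bool → ℝ) (l : Bool) : ℝ := α l * ((side s L l : ℕ) : ℝ) ^ d / ((side s L l : ℕ) : ℝ) ^ 2

/-- Non-negative coefficients give non-negative weights (`ha` of the ENDs). [folklore] -/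
theorem treeWeight_nonneg {α : Bool → ℝ} (hα : ∀ l, 0 ≤ α l) (l : Bool) : 0 ≤ treeWeight d s L α l := by
  unfold treeWeight; exact div_nonneg (mul_nonneg (hα l) (by positivity)) (by positivity)

/-- **THE PRINT-SIZE IDENTITY**: `a_l·ω_l(corner_k)²·S_l^d = α_l ∕ S_l²` EXACTLY on every cell (J1 (D1): «no hidden scale»). [folklore] -/
theorem scale_eq (α : Bool → ℝ) (k : Cell s L Λ) :
    treeWeight d s L α (lvl k) * meanProfile hs hL hdiv Λ (lvl k) (ctrU N (side s L (lvl k)) (zc hs hL hdiv k)) ^ 2 *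
        ((side s L (lvl k) : ℕ) : ℝ) ^ d = α (lvl k) / ((side s L (lvl k) : ℕ) : ℝ) ^ 2 := by
  rw [meanProfile_corner, treeWeight]
  have hS : (0 : ℝ) < ((side s L (lvl k) : ℕ) : ℝ) := by exact_mod_cast side_pos hs hL (lvl k)
  have hSd : (0 : ℝ) < ((side s L (lvl k) : ℕ) : ℝ) ^ d := by positivity
  field_simp

/-- **`hscale_lo` OF THE (L1) ENDs FOR THE SLOT FAMILY** from `a_min ≤ α_l`. [folklore] -/
theorem scale_lo {α : Bool → ℝ} {amin : ℝ} (hα : ∀ l, amin ≤ α l) (k : Cell s L Λ) :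
    amin / ((side s L (lvl k) : ℕ) : ℝ) ^ 2 ≤
      treeWeight d s L α (lvl k) * meanProfile hs hL hdiv Λ (lvl k) (ctrU N (side s L (lvl k)) (zc hs hL hdiv k)) ^ 2 *
        ((side s L (lvl k) : ℕ) : ℝ) ^ d := by
  rw [scale_eq]
  exact div_le_div_of_nonneg_right (hα _) (by positivity)

/-- **`hscale_hi` OF THE (L1) ENDs FOR THE SLOT FAMILY** from `α_l ≤ a_max`. [folklore] -/
theorem scale_hi {α : Bool → ℝ} {amax : ℝ} (hα : ∀ l, α l ≤ amax) (k : Cell s L Λ) :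
    treeWeight d s L α (lvl k) * meanProfile hs hL hdiv Λ (lvl k) (ctrU N (side s L (lvl k)) (zc hs hL hdiv k)) ^ 2 *
        ((side s L (lvl k) : ℕ) : ℝ) ^ d ≤ amax / ((side s L (lvl k) : ℕ) : ℝ) ^ 2 := by
  rw [scale_eq]
  exact div_le_div_of_nonneg_right (hα _) (by positivity)

/-! ## §5 END: the flat k-uniform decay on the slot family with every geometric binder discharged -/

/-- **THE k-UNIFORM DECAY OF `Δ + Σ_l a_lG_lᵀG_l` ON THE SLOT FAMILY AT `U = 1`, NO GEOMETRIC HYPOTHESIS (MODEL).**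
`MultiscaleDecay.decay_levelOp_flat` FIRED BY NAME on the two-level slot family of §2 with the J1 profile ∕ weights of §4: for bond weights
`0 < c_min ≤ |c_b| ≤ c_max`, level coefficients `a_min ≤ α_l ≤ a_max` (`0 ≤ a_min`), a rate `κ ∈ [0,1]` with
`μ₀ = min(c_min²∕(4d), a_min∕2) − 2d·c_max²κ² − a_max(e^{2dκ} − 1) > 0`: the operator is a unit and
`|(levelOp)⁻¹(p,q)| ≤ e^{−κ·d_n(p,q)}·n(p)n(q)∕μ₀` with `n = s` on the slot, `L·s` off it (`siteScale_eq`).  The five geometric terms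
`cells_disjoint cells_cover meanProfile_supp scale_lo scale_hi` are the ones the covariant END `decay_levelOp_cov` takes as well. [folklore] -/
theorem decay_levelOp_flat_slot [NeZero d] {Cp : Type} [Fintype Cp] [DecidableEq Cp]
    {α : Bool → ℝ} {amin amax : ℝ} (hamin : 0 ≤ amin) (hα_lo : ∀ l, amin ≤ α l) (hα_hi : ∀ l, α l ≤ amax)
    (c : UT N × Fin d → ℝ) {cmin cmax : ℝ} (hcmin : 0 < cmin) (hc_lo : ∀ b, cmin ≤ |c b|) (hc_hi : ∀ b, |c b| ≤ cmax)
    {κ : ℝ} (hκ0 : 0 ≤ κ) (hκ1 : κ ≤ 1)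
    (hμ : 0 < min (cmin ^ 2 / (4 * d)) (amin / 2) - 2 * d * cmax ^ 2 * κ ^ 2 - amax * (Real.exp (2 * d * κ) - 1))
    (p q : UT N × Cp) :
    IsUnit (levelOp bsrc btgt c (fun _ => (oneM : Cp → Cp → ℝ))
        (fun l x => ctrU N (side s L l) (tblk (side_pos hs hL l) (side_dvd hdiv l) x))
        (fun l x => meanProfile hs hL hdiv Λ l (ctrU N (side s L l) (tblk (side_pos hs hL l) (side_dvd hdiv l) x)))
        (fun _ _ => (oneM : Cp → Cp → ℝ)) (treeWeight d s L α)) ∧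
      |Ring.inverse (levelOp bsrc btgt c (fun _ => (oneM : Cp → Cp → ℝ))
          (fun l x => ctrU N (side s L l) (tblk (side_pos hs hL l) (side_dvd hdiv l) x))
          (fun l x => meanProfile hs hL hdiv Λ l (ctrU N (side s L l) (tblk (side_pos hs hL l) (side_dvd hdiv l) x)))
          (fun _ _ => (oneM : Cp → Cp → ℝ)) (treeWeight d s L α)) (Pi.single q 1) p| ≤
        Real.exp (-(κ * sdist bsrc btgt
            (siteScale (side s L) (side_pos hs hL) (side_dvd hdiv) lvl (zc hs hL hdiv) (cells_cover (Λ := Λ) hs hL hdiv)) p.1 q.1)) *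
          ((siteScale (side s L) (side_pos hs hL) (side_dvd hdiv) lvl (zc hs hL hdiv) (cells_cover (Λ := Λ) hs hL hdiv) p.1 : ℝ) *
            (siteScale (side s L) (side_pos hs hL) (side_dvd hdiv) lvl (zc hs hL hdiv) (cells_cover (Λ := Λ) hs hL hdiv) q.1 : ℝ)) /
          (min (cmin ^ 2 / (4 * d)) (amin / 2) - 2 * d * cmax ^ 2 * κ ^ 2 - amax * (Real.exp (2 * d * κ) - 1)) :=
  decay_levelOp_flat (side s L) (side_pos hs hL) (side_dvd hdiv) lvl (zc hs hL hdiv) (cells_disjoint hs hL hdiv)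
    (cells_cover hs hL hdiv) (treeWeight d s L α) (treeWeight_nonneg fun l => hamin.trans (hα_lo l)) (meanProfile hs hL hdiv Λ)
    (meanProfile_supp hs hL hdiv) hamin (hamin.trans ((hα_lo true).trans (hα_hi true))) (scale_lo hs hL hdiv hα_lo)
    (scale_hi hs hL hdiv hα_hi) c hcmin hc_lo hc_hi hκ0 hκ1 hμ p q

/-- NON-VACUITY (rule G-1): the END FIRES on leaf-05-g12's J1b toy geometry — `d = 4`, torus `4⁴`, `s = 1`, `L = 2`, ANY slot `Λ`,
`c ≡ 1`, `α ≡ 1`, `κ = 0` — with EVERY remaining hypothesis discharged by `norm_num`. [folklore] -/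
example (Λ : Finset (Ctr (fun _ : Fin 4 => 4) (2 * 1))) (p q : UT (fun _ : Fin 4 => 4) × Unit) :=
  decay_levelOp_flat_slot (Λ := Λ) le_rfl (by norm_num) (fun _ => ⟨2, rfl⟩) (α := fun _ => 1) (amin := 1) (amax := 1) zero_le_one
    (fun _ => le_rfl) (fun _ => le_rfl) (fun _ => 1) (cmin := 1) (cmax := 1) one_pos (fun _ => by simp) (fun _ => by simp) (κ := 0)
    le_rfl zero_le_one (by norm_num) p q

/-- DESIGNED SIZES (owner table S117, test (a)): the slot's unit cells of `L^j` fine sites inside the next coarser layer of `L^{j+1}`-cells on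
a four-torus of `L^{j+1}·T` fine sites per axis, ANY slot `Λ` — the family and its binders take NO numeric input beyond `1 ≤ L`. [folklore] -/
example {L j T : ℕ} [NeZero (L ^ (j + 1) * T)] (hL : 1 ≤ L)
    (Λ : Finset (Ctr (fun _ : Fin 4 => L ^ (j + 1) * T) (L * L ^ j))) (x : UT (fun _ : Fin 4 => L ^ (j + 1) * T)) :
    ∃ (k : Cell (L ^ j) L Λ) (v : Box 4 (side (L ^ j) L (lvl k))),
      cellPt (side (L ^ j) L) (side_pos (Nat.one_le_pow _ _ hL) hL) (side_dvd fun _ => ⟨T, by ring⟩) lvl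
        (zc (Nat.one_le_pow _ _ hL) hL fun _ => ⟨T, by ring⟩) k v = x :=
  cells_cover _ _ _ x

end Family

end Summit.QuantumFields.BalabanUV.T4Continuum.ShellMeasureSlotCubeFamily

end
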